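import Literature.NumberTheory.LFunctions.ZetaMulRpowSumUpperBound
import Literature.NumberTheory.LFunctions.ExceptionalPrimesMainTerm
import Literature.NumberTheory.LFunctions.CharacterHarmonicTails
import Literature.NumberTheory.LFunctions.RealCharacterLadderLeaves
import Literature.NumberTheory.LFunctions.ClassGroupLFunctionExceptionalZeroQuadraticField
import Literature.NumberTheory.QuadraticFields.QuadraticDedekindZetaKronecker
import Literature.NumberTheory.QuadraticFields.ImaginaryResiduePiForm
import Mathlib.Analysis.SpecialFunctions.Log.Monotone
import HarnessLib

/-!
# Hecke's lemma with an explicit constant, kernel-proved: no real zero on `[1 − 1/(4 log q), 1]`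
# ⇒ `L(1, χ) ≥ 1/(12 log q)` (`q ≥ 10⁴`); fact-free consumers `NoRealZeroUpTo Q ⇒ L(1,χ) ≥ 1/(12 log q)`,
# `h(−d) ≥ √d/(12π log d)`

Topic `Literature/NumberTheory/LFunctions`. Everything in this file is PROVED (theorems only; no
definition, no named fact). Hecke's lemma (Montgomery–Vaughan Thm. 11.14 Case A; Hoffstein 1980 Lemma 1
prints `1/(1.502 log|d|)`): no zero of the real `L(s, χ)` on `1 − c/log q ≤ s ≤ 1` ⇒ `L(1,χ) ≫_c 1/log q`.
The tree's `Siegel.caseA` has Estermann's constant `c_E ≈ 7·10⁻⁵`; here the one-sided hyperbola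
estimate of `ZetaMulRpowSumUpperBound.lean` at `β = 1 − 1/(4 log q)`, `X = q⁴`, `D = q²`
(`X^{1−β} = e`, `D^{−β} = √e/q²`, `A(D) ≤ 1 + 2√e log q`, `∑_{d ≤ q²} χ(d)/d ≤ L(1,χ) + 2q/(q²+1)`)
gives `1 ≤ 4e log q · L(1, χ) + 0.022 + 0.025` for `q ≥ 10⁴`:

* `Hecke.lOne_ge_of_noRealZero_near_one` — **quadratic `χ ≠ χ₀` mod `q ≥ 10⁴`, `L(σ, χ) ≠ 0` on
  `[1 − 1/(4 log q), 1]` ⇒ `Re L(1, χ) ≥ 1/(12 log q)`**;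
* `Hecke.lOne_ge_of_noRealZeroUpTo` — **FACT-FREE certified-range consumer**: `NoRealZeroUpTo Q` ⇒
  `Re L(1, χ) ≥ 1/(12 log q)` for every primitive quadratic `χ` mod `q`, `10⁴ ≤ q ≤ Q`; leaf instances
  `lOne_ge_of_leaf_1e10` (booked decade), `lOne_ge_of_leaf_3e10` (value-free until the rung books);
* `Hecke.classNumber_ge_of_noRealZeroUpTo` / `_leaf_1e10` — `h_K ≥ √|d_K|/(12π log|d_K|)` for imaginary
  quadratic `K`, `10⁴ ≤ |d_K| ≤ Q` (class number formula, `w_K = 2`).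

Kernel version of the parity cell's consumer C9 (`SiegelTatuzawa.lOne_gt_of_noRealZeroUpTo`, `1/(1.502
log q)` MODULO `hoffstein1980_lemma1`): 8× weaker than Hoffstein, `≈ 770×` the class-number-formula floor
`0.69/√q` at `q = 10¹⁰`, resting on nothing unproved. LABEL: instrument / proof-of-data consumer
(kernel; explicit constant). WHAT THIS IS NOT: not Hoffstein's constant; the window `1/(4 log q)` is
fixed (a window `c/log q` gives `e^{4c}/c` for `4e`).

## References

* H. L. Montgomery, R. C. Vaughan, *Multiplicative Number Theory I*, CUP 2007, §11.2 Theorem 11.14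
  (Case A) and §2.1. [MontgomeryVaughan2007]
* J. Hoffstein, *On the Siegel–Tatuzawa theorem*, Acta Arith. 38 (1980), Lemma 1 p. 168, (17) p. 173.
  [Hoffstein1980SiegelTatuzawa]
* J. Neukirch, *Algebraic Number Theory*, Ch. VII §5 (5.11). [NeukirchANT1999]
-/

noncomputable section

open Complex Filter Topology Finset
open Literature.NumberTheory.LFunctions.DirichletAbel
open Literature.NumberTheory.LFunctions.SiegelZero

namespace Literature.NumberTheory.LFunctions.Hecke

variable {q : ℕ} [NeZero q] (χ : DirichletCharacter ℂ q)

/-! ### Numerical lemmas -/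

/-- `log q ≥ 9` for `q ≥ 10⁴` (`e⁹ < 2.7182818286⁹ < 8104 < 10⁴`). [folklore] -/
private theorem nine_le_log {q : ℕ} (hq : 10 ^ 4 ≤ q) : (9 : ℝ) ≤ Real.log q := by
  have hq' : (10 : ℝ) ^ 4 ≤ q := by exact_mod_cast hq
  rw [Real.le_log_iff_exp_le (by linarith)]
  have h1 : Real.exp 9 = Real.exp 1 ^ 9 := by rw [← Real.exp_nat_mul]; norm_num
  have h9 : Real.exp 1 ^ 9 ≤ 2.7182818286 ^ 9 :=
    pow_le_pow_left₀ (Real.exp_pos 1).le Real.exp_one_lt_d9.le 9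
  rw [h1]
  calc Real.exp 1 ^ 9 ≤ 2.7182818286 ^ 9 := h9
    _ ≤ (10 : ℝ) ^ 4 := by norm_num
    _ ≤ q := hq'

/-- `log q ≤ q/1000` for `q ≥ 10⁴` (`log x/x` decreases on `x ≥ e`; `log 10⁴ ≤ 10 ≤ 10⁴/1000` as
`2.7182818283¹⁰ > 10⁴`). [folklore] -/
private theorem log_le_div_thousand {q : ℕ} (hq : 10 ^ 4 ≤ q) : Real.log q ≤ (q : ℝ) / 1000 := by
  have hq' : (10 : ℝ) ^ 4 ≤ q := by exact_mod_cast hq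
  have hq0 : (0 : ℝ) < q := by linarith
  have he1 : Real.exp 1 ≤ (10 : ℝ) ^ 4 := le_trans Real.exp_one_lt_d9.le (by norm_num)
  have hanti := Real.log_div_self_antitoneOn (a := (10 : ℝ) ^ 4) (b := (q : ℝ))
    (by simpa using he1) (by simpa using he1.trans hq') hq'
  -- `log 10⁴ ≤ 10`
  have hlog4 : Real.log ((10 : ℝ) ^ 4) ≤ 10 := by
    rw [Real.log_le_iff_le_exp (by norm_num)]
    have h1 : Real.exp 10 = Real.exp 1 ^ 10 := by rw [← Real.exp_nat_mul]; norm_num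
    have h10 : (2.7182818283 : ℝ) ^ 10 ≤ Real.exp 1 ^ 10 :=
      pow_le_pow_left₀ (by norm_num) Real.exp_one_gt_d9.le 10
    rw [h1]
    exact le_trans (by norm_num) h10
  have h2 : Real.log q / q ≤ Real.log ((10 : ℝ) ^ 4) / 10 ^ 4 := hanti
  have h3 : Real.log ((10 : ℝ) ^ 4) / 10 ^ 4 ≤ 1 / 1000 := by
    rw [div_le_div_iff₀ (by norm_num) (by norm_num)]; linarith
  have h4 : Real.log q / q ≤ 1 / 1000 := h2.trans h3
  rwa [div_le_iff₀ hq0, one_div_mul_eq_div] at h4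

/-- `e^{1/2} < 1.65` (`(e^{1/2})² = e < 2.72 < 1.65²`). [folklore] -/
private theorem exp_half_lt : Real.exp (1 / 2) < 1.65 := by
  have h2 : Real.exp (1 / 2) ^ 2 = Real.exp 1 := by rw [← Real.exp_nat_mul]; norm_num
  have he := Real.exp_one_lt_d9
  by_contra hcon
  push Not at hcon
  have : (1.65 : ℝ) ^ 2 ≤ Real.exp (1 / 2) ^ 2 := pow_le_pow_left₀ (by norm_num) hcon 2
  rw [h2] at this
  linarith [show (2.7182818286 : ℝ) < 1.65 ^ 2 by norm_num]

/-! ### Hecke's lemma, explicit -/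

/-- The two error terms at `q ≥ 10⁴` (`L = log q ≤ q/1000`): `4eL · 2q/(q²+1) ≤ 0.0218` and
`2(√e/q²)((q+1)(1 + 2√e L) + 4Lq) ≤ 0.0245`. [folklore] -/
private theorem error_terms_le {q : ℕ} (hq : 10 ^ 4 ≤ q) :
    4 * Real.exp 1 * Real.log q * (2 * q / ((q : ℝ) ^ 2 + 1)) ≤ 0.0218 ∧
    2 * (Real.exp (1 / 2) / (q : ℝ) ^ 2) *
      ((q + 1) * (1 + Real.exp (1 / 2) * (2 * Real.log q)) + 4 * Real.log q * q) ≤ 0.0245 := by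
  set L : ℝ := Real.log q with hLdef
  have hqr : (10 : ℝ) ^ 4 ≤ q := by exact_mod_cast hq
  have hq1 : (10000 : ℝ) ≤ q := by linarith [hqr, show (10 : ℝ) ^ 4 = 10000 by norm_num]
  have hq0 : (0 : ℝ) < q := by linarith
  have hL9 : 9 ≤ L := nine_le_log hq
  have hL0 : 0 < L := by linarith
  have hLq : L ≤ (q : ℝ) / 1000 := log_le_div_thousand hq
  have he := Real.exp_one_lt_d9
  have he0 := Real.exp_pos (1 : ℝ)
  have hs := exp_half_lt
  have hs0 := Real.exp_pos (1 / 2 : ℝ)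
  have hu : L / q ≤ 1 / 1000 := by rw [div_le_iff₀ hq0]; linarith
  have hu0 : 0 ≤ L / q := by positivity
  constructor
  · have h1 : 2 * q / ((q : ℝ) ^ 2 + 1) ≤ 2 / q := by
      rw [div_le_div_iff₀ (by positivity) hq0]; nlinarith
    have h2 : Real.exp 1 * (L / q) ≤ 2.7182818286 * (1 / 1000) :=
      mul_le_mul he.le hu hu0 (by norm_num)
    calc 4 * Real.exp 1 * L * (2 * q / ((q : ℝ) ^ 2 + 1)) ≤ 4 * Real.exp 1 * L * (2 / q) :=
          mul_le_mul_of_nonneg_left h1 (by positivity)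
      _ = 8 * (Real.exp 1 * (L / q)) := by ring
      _ ≤ 8 * (2.7182818286 * (1 / 1000)) := by linarith
      _ ≤ 0.0218 := by norm_num
  · have hq2pos : (0 : ℝ) < (q : ℝ) ^ 2 := by positivity
    have hT0 : 0 ≤ (q + 1) * (1 + Real.exp (1 / 2) * (2 * L)) + 4 * L * q := by positivity
    have hT' : (q + 1) * (1 + Real.exp (1 / 2) * (2 * L)) + 4 * L * q ≤
        (q + 1) * (1 + 1.65 * (2 * L)) + 4 * L * q := by
      have h1 : Real.exp (1 / 2) * (2 * L) ≤ 1.65 * (2 * L) :=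
        mul_le_mul_of_nonneg_right hs.le (by positivity)
      have := mul_le_mul_of_nonneg_left (show 1 + Real.exp (1 / 2) * (2 * L) ≤ 1 + 1.65 * (2 * L)
        by linarith) (show (0 : ℝ) ≤ q + 1 by positivity)
      linarith
    have hs' : 2 * (Real.exp (1 / 2) / (q : ℝ) ^ 2) ≤ 2 * (1.65 / (q : ℝ) ^ 2) := by
      have := div_le_div_of_nonneg_right hs.le hq2pos.le
      linarith
    have hqq : (10000 : ℝ) * q ≤ (q : ℝ) ^ 2 := by
      rw [sq]; exact mul_le_mul_of_nonneg_right hq1 hq0.le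
    have hv : ((q : ℝ) + 1) / q ^ 2 ≤ 10001 / 100000000 := by
      rw [div_le_div_iff₀ hq2pos (by norm_num)]; linarith [hqq, hq1]
    have hw : ((q : ℝ) + 1) / q ≤ 10001 / 10000 := by
      rw [div_le_div_iff₀ hq0 (by norm_num)]; linarith [hq1]
    have hw0 : 0 ≤ ((q : ℝ) + 1) / q := by positivity
    have huw : L / q * (((q : ℝ) + 1) / q) ≤ 1 / 1000 * (10001 / 10000) :=
      mul_le_mul hu hw hw0 (by norm_num)
    have hid : 2 * (1.65 / (q : ℝ) ^ 2) * ((q + 1) * (1 + 1.65 * (2 * L)) + 4 * L * q) =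
        3.3 * (((q : ℝ) + 1) / q ^ 2 + 3.3 * (L / q * ((q + 1) / q)) + 4 * (L / q)) := by
      field_simp
      ring
    calc 2 * (Real.exp (1 / 2) / (q : ℝ) ^ 2) *
          ((q + 1) * (1 + Real.exp (1 / 2) * (2 * L)) + 4 * L * q)
        ≤ 2 * (1.65 / (q : ℝ) ^ 2) * ((q + 1) * (1 + 1.65 * (2 * L)) + 4 * L * q) :=
          mul_le_mul hs' hT' hT0 (by positivity)
      _ = 3.3 * (((q : ℝ) + 1) / q ^ 2 + 3.3 * (L / q * ((q + 1) / q)) + 4 * (L / q)) := hid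
      _ ≤ 3.3 * (10001 / 100000000 + 3.3 * (1 / 1000 * (10001 / 10000)) + 4 * (1 / 1000)) := by
          linarith
      _ ≤ 0.0245 := by norm_num

/-- The hyperbola inequality at `β = 1 − 1/(4 log q)`, `X = q⁴`, `D = q²`, with the powers evaluated:
`1 ≤ 4e log q · ∑_{d ≤ q²} χ(d)/d + 2(√e/q²)((q+1) A + 4 log q · q)`, `A = ∑_{e ≤ q²} e^{−β}`, whenever
`Re L(β, χ) ≥ 0` (`χ ≠ χ₀` quadratic, `q ≥ 10⁴`). [cite: MontgomeryVaughan2007, §11.2 Thm. 11.14 (Case A) and §2.1] -/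
private theorem one_le_main_add_error (hq : 10 ^ 4 ≤ q) (hχ : χ ≠ 1) (hq2 : χ ^ 2 = 1)
    (hpos : 0 ≤ (χ.LFunction ((1 - 1 / (4 * Real.log q) : ℝ) : ℂ)).re) :
    1 ≤ 4 * Real.exp 1 * Real.log q * ∑ d ∈ Icc 1 (q ^ 2), (χ (d : ZMod q)).re / d +
      2 * (Real.exp (1 / 2) / (q : ℝ) ^ 2) *
        ((q + 1) * ∑ e ∈ Icc 1 (q ^ 2), (e : ℝ) ^ (-(1 - 1 / (4 * Real.log q))) +
          4 * Real.log q * q) := by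
  set L : ℝ := Real.log q with hLdef
  have hqr : (10 : ℝ) ^ 4 ≤ q := by exact_mod_cast hq
  have hq0 : (0 : ℝ) < q := by linarith
  have hL9 : 9 ≤ L := nine_le_log hq
  have hL0 : 0 < L := by linarith
  set β : ℝ := 1 - 1 / (4 * L) with hβdef
  have hκ : 1 - β = 1 / (4 * L) := by rw [hβdef]; ring
  have hβ1 : β < 1 := by
    have h4 : (0 : ℝ) < 1 / (4 * L) := by positivity
    rw [hβdef]; linarith
  have hβ0 : 0 < β := by
    have : 1 / (4 * L) ≤ 1 / 36 := one_div_le_one_div_of_le (by norm_num) (by linarith)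
    rw [hβdef]; linarith
  -- the hyperbola estimate at `X = q⁴`
  have hX : 1 ≤ q ^ 4 := Nat.one_le_pow _ _ (by omega)
  have hD : Nat.sqrt (q ^ 4) = q ^ 2 := by
    rw [show q ^ 4 = q ^ 2 * q ^ 2 by ring, Nat.sqrt_eq]
  have hmain := sum_re_zetaMul_mul_rpow_sub_main_le_of_nonneg χ hχ hq2 hβ0 hβ1 hpos hX
  have hG := one_le_sum_zetaMul_rpow χ hq2 β hX
  rw [hD] at hmain
  -- the exact values of the powers
  have hq4r : ((q ^ 4 : ℕ) : ℝ) = (q : ℝ) ^ 4 := by push_cast; ring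
  have hq2r : ((q ^ 2 : ℕ) : ℝ) = (q : ℝ) ^ 2 := by push_cast; ring
  have hlog4 : Real.log ((q : ℝ) ^ 4) = 4 * L := by
    rw [Real.log_pow, ← hLdef]; push_cast; ring
  have hlog2 : Real.log ((q : ℝ) ^ 2) = 2 * L := by
    rw [Real.log_pow, ← hLdef]; push_cast; ring
  have hXpow : ((q ^ 4 : ℕ) : ℝ) ^ (1 - β) = Real.exp 1 := by
    rw [hq4r, Real.rpow_def_of_pos (by positivity), hlog4, hκ]
    congr 1
    field_simp
  have hexpL : Real.exp (2 * L) = (q : ℝ) ^ 2 := by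
    rw [show (2 : ℝ) * L = ((2 : ℕ) : ℝ) * L by push_cast; ring, Real.exp_nat_mul, hLdef,
      Real.exp_log hq0]
  have hDpow : ((q ^ 2 : ℕ) : ℝ) ^ (-β) = Real.exp (1 / 2) / (q : ℝ) ^ 2 := by
    rw [hq2r, Real.rpow_def_of_pos (by positivity), hlog2]
    have e1 : 2 * L * -β = 1 / 2 - 2 * L := by
      rw [hβdef]; field_simp; ring
    rw [e1, Real.exp_sub, hexpL]
  rw [hXpow, hDpow, hκ] at hmain
  have hE : Real.exp 1 / (1 / (4 * L)) = 4 * Real.exp 1 * L := by field_simp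
  have hT : (q : ℝ) / (1 / (4 * L)) = 4 * L * q := by field_simp
  rw [hE, hT] at hmain
  linarith

/-- **Hecke's lemma with an explicit constant (kernel)**: for every quadratic `χ ≠ χ₀` mod `q ≥ 10⁴`,
if `L(σ, χ) ≠ 0` for all real `σ ∈ [1 − 1/(4 log q), 1]`, then **`Re L(1, χ) ≥ 1/(12 log q)`**.
(Hyperbola method at `β = 1 − 1/(4 log q)` with `X = q⁴`, `D = q²`:
`1 ≤ ∑_{n≤q⁴}(1∗χ)(n)n^{−β} ≤ 4e log q (Re L(1,χ) + 2q/(q²+1)) + 2√e q^{−2}((q+1)(1+2√e log q) + 4q log q)`,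
and the two error terms are `≤ 0.022 + 0.025`.) [cite: MontgomeryVaughan2007, §11.2 Thm. 11.14 (Case A)]
[cite: Hoffstein1980SiegelTatuzawa, Lemma 1 p. 168] -/
theorem lOne_ge_of_noRealZero_near_one (hq : 10 ^ 4 ≤ q) (hχ : χ ≠ 1) (hq2 : χ ^ 2 = 1)
    (hz : ∀ σ : ℝ, 1 - 1 / (4 * Real.log q) ≤ σ → σ ≤ 1 → χ.LFunction σ ≠ 0) :
    1 / (12 * Real.log q) ≤ (χ.LFunction 1).re := by
  set L : ℝ := Real.log q with hLdef
  have hqr : (10 : ℝ) ^ 4 ≤ q := by exact_mod_cast hq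
  have hq0 : (0 : ℝ) < q := by linarith
  have hL9 : 9 ≤ L := nine_le_log hq
  have hL0 : 0 < L := by linarith
  set β : ℝ := 1 - 1 / (4 * L) with hβdef
  have hκ : 1 - β = 1 / (4 * L) := by rw [hβdef]; ring
  have hβ1 : β < 1 := by
    have h4 : (0 : ℝ) < 1 / (4 * L) := by positivity
    rw [hβdef]; linarith
  have hβ0 : 0 < β := by
    have : 1 / (4 * L) ≤ 1 / 36 := one_div_le_one_div_of_le (by norm_num) (by linarith)
    rw [hβdef]; linarith
  -- positivity of `L(β, χ)`
  have hpos : 0 < (χ.LFunction β).re :=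
    LFunction_ofReal_re_pos_of_forall_ne_zero χ hχ hq2 hβ0 hβ1.le hz
  have hmain := one_le_main_add_error χ hq hχ hq2 hpos.le
  set S₁ : ℝ := ∑ d ∈ Icc 1 (q ^ 2), (χ (d : ZMod q)).re / d with hS₁
  set A : ℝ := ∑ e ∈ Icc 1 (q ^ 2), (e : ℝ) ^ (-β) with hA
  -- `A ≤ 1 + √e · 2 log q`
  have hq2r : ((q ^ 2 : ℕ) : ℝ) = (q : ℝ) ^ 2 := by push_cast; ring
  have hlog2 : Real.log ((q : ℝ) ^ 2) = 2 * L := by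
    rw [Real.log_pow, ← hLdef]; push_cast; ring
  have hD1pow : ((q ^ 2 : ℕ) : ℝ) ^ (1 - β) = Real.exp (1 / 2) := by
    rw [hq2r, Real.rpow_def_of_pos (by positivity), hlog2, hκ]
    congr 1
    field_simp
    norm_num
  have hAle : A ≤ 1 + Real.exp (1 / 2) * (2 * L) := by
    have h := sum_Icc_rpow_le_log hβ0.le hβ1 (N := q ^ 2) (Nat.one_le_pow _ _ (by omega))
    rw [hD1pow, hq2r, hlog2] at h
    rw [hA]; exact h
  -- `S₁ ≤ Re L(1,χ) + 2q/(q²+1)`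
  have hS₁le : S₁ ≤ (χ.LFunction 1).re + 2 * q / ((q : ℝ) ^ 2 + 1) := by
    have hW := CharacterTails.norm_sum_Icc_div_sub_LFunction_one_le χ hχ (W := 2 * q)
      (N := q ^ 2) fun n => norm_sum_Ioc_apply_le χ hχ (q ^ 2) n
    have e : ∑ n ∈ Icc 1 (q ^ 2), χ (n : ZMod q) / n = ((S₁ : ℝ) : ℂ) := by
      rw [hS₁, Complex.ofReal_sum]
      refine Finset.sum_congr rfl fun n _ => ?_
      rw [apply_eq_ofReal_re χ hq2]
      push_cast
      simp
    rw [e] at hW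
    have hre := Complex.abs_re_le_norm (((S₁ : ℝ) : ℂ) - χ.LFunction 1)
    rw [Complex.sub_re, Complex.ofReal_re] at hre
    have h3 := (abs_le.mp (hre.trans hW)).2
    push_cast at h3
    linarith
  -- the error terms
  obtain ⟨hE1, hE2⟩ := error_terms_le hq
  have he := Real.exp_one_lt_d9
  have he0 := Real.exp_pos (1 : ℝ)
  have hs0 := Real.exp_pos (1 / 2 : ℝ)
  -- `4eL·S₁ ≤ 4eL·Re L(1,χ) + 0.0218`
  have h1 : 4 * Real.exp 1 * L * S₁ ≤
      4 * Real.exp 1 * L * (χ.LFunction 1).re + 0.0218 := by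
    have := mul_le_mul_of_nonneg_left hS₁le (show 0 ≤ 4 * Real.exp 1 * L by positivity)
    linarith
  -- the error term is monotone in `A`
  have h2 : 2 * (Real.exp (1 / 2) / (q : ℝ) ^ 2) * ((q + 1) * A + 4 * L * q) ≤ 0.0245 := by
    have hmono : (q + 1) * A + 4 * L * q ≤ (q + 1) * (1 + Real.exp (1 / 2) * (2 * L)) + 4 * L * q := by
      have := mul_le_mul_of_nonneg_left hAle (show (0 : ℝ) ≤ q + 1 by positivity)
      linarith
    have := mul_le_mul_of_nonneg_left hmono
      (show 0 ≤ 2 * (Real.exp (1 / 2) / (q : ℝ) ^ 2) by positivity)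
    linarith
  -- conclude: `4eL · Re L(1,χ) ≥ 1 − 0.0463`
  have hkey : 0.9537 ≤ 4 * Real.exp 1 * (L * (χ.LFunction 1).re) := by
    have : 1 ≤ 4 * Real.exp 1 * L * S₁ + 2 * (Real.exp (1 / 2) / (q : ℝ) ^ 2) *
        ((q + 1) * A + 4 * L * q) := hmain
    linarith
  have hprodpos : 0 < L * (χ.LFunction 1).re := by
    by_contra hcon
    push Not at hcon
    nlinarith
  have hprod : 0.9537 ≤ 4 * 2.7182818286 * (L * (χ.LFunction 1).re) := by
    have := mul_le_mul_of_nonneg_right he.le hprodpos.le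
    linarith
  rw [div_le_iff₀ (by positivity)]
  nlinarith

/-! ### The certified-range consumer (fact-free) -/

/-- **`L(1, χ) ≥ 1/(12 log q)` on a certified zero-free range, kernel only**: if `NoRealZeroUpTo Q`
(every real primitive `L(s, χ)` with `q ≤ Q` is zero-free on `(0, 1)`), then for every primitive
quadratic `χ` mod `q` with `10⁴ ≤ q ≤ Q`: `Re L(1, χ) ≥ 1/(12 log q)`. No named fact is used
(compare `SiegelTatuzawa.lOne_gt_of_noRealZeroUpTo`: `1/(1.502 log q)` modulo `hoffstein1980_lemma1`).
[cite: MontgomeryVaughan2007, §11.2 Thm. 11.14 (Case A)] [cite: Hoffstein1980SiegelTatuzawa, Lemma 1 p. 168] -/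
theorem lOne_ge_of_noRealZeroUpTo {Q : ℕ} (hZ : NoRealZeroUpTo Q) (hq : 10 ^ 4 ≤ q) (hqQ : q ≤ Q)
    (hprim : χ.IsPrimitive) (hquad : χ.IsQuadratic) :
    1 / (12 * Real.log q) ≤ (χ.LFunction 1).re := by
  have hne : χ ≠ 1 := by
    rintro rfl
    rw [DirichletCharacter.isPrimitive_def, DirichletCharacter.conductor_one] at hprim
    omega
  have hL9 : 9 ≤ Real.log q := nine_le_log hq
  refine lOne_ge_of_noRealZero_near_one χ hq hne hquad.sq_eq_one fun σ h1 h2 => ?_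
  have hσ0 : 0 < σ := by
    have : 1 / (4 * Real.log q) ≤ 1 / 36 := one_div_le_one_div_of_le (by norm_num) (by linarith)
    linarith
  rcases lt_or_eq_of_le h2 with h2 | rfl
  · exact hZ q (by omega) hqQ χ hquad hprim σ hσ0 h2
  · rw [Complex.ofReal_one]
    exact χ.LFunction_apply_one_ne_zero hne

/-- The booked decade leaf: `NoRealZeroUpTo_1e10` (both parities, `q ≤ 10¹⁰`, two certified lineages)
gives `Re L(1, χ) ≥ 1/(12 log q)` for every primitive quadratic `χ` mod `q`, `10⁴ ≤ q ≤ 10¹⁰` —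
fact-free. [cite: MontgomeryVaughan2007, §11.2 Thm. 11.14 (Case A)] -/
theorem lOne_ge_of_leaf_1e10 (hZ : NoRealZeroUpTo_1e10) (hq : 10 ^ 4 ≤ q) (hqQ : q ≤ 10 ^ 10)
    (hprim : χ.IsPrimitive) (hquad : χ.IsQuadratic) :
    1 / (12 * Real.log q) ≤ (χ.LFunction 1).re :=
  lOne_ge_of_noRealZeroUpTo χ hZ hq (by norm_num at hqQ ⊢; exact hqQ) hprim hquad

/-- The wide rung leaf at `3·10¹⁰` (`NoRealZeroUpTo_3e10`; odd rung booked, even rung route G in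
flight — value-free until it books): `Re L(1, χ) ≥ 1/(12 log q)` for `10⁴ ≤ q ≤ 3·10¹⁰`, fact-free.
[cite: MontgomeryVaughan2007, §11.2 Thm. 11.14 (Case A)] -/
theorem lOne_ge_of_leaf_3e10 (hZ : NoRealZeroUpTo_3e10) (hq : 10 ^ 4 ≤ q) (hqQ : q ≤ 3 * 10 ^ 10)
    (hprim : χ.IsPrimitive) (hquad : χ.IsQuadratic) :
    1 / (12 * Real.log q) ≤ (χ.LFunction 1).re :=
  lOne_ge_of_noRealZeroUpTo χ hZ hq (by norm_num at hqQ ⊢; exact hqQ) hprim hquad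

/-! ### The class-number form -/

/-- A Dirichlet character with `κ² = 1` is quadratic in Mathlib's sense. [folklore] -/
private theorem isQuadratic_of_sq_eq_one {M : ℕ} (κ : DirichletCharacter ℂ M) (h : κ ^ 2 = 1) :
    κ.IsQuadratic := by
  intro a
  by_cases ha : IsUnit a
  · have h2 : κ a ^ 2 = 1 := by
      have := congrArg (fun ψ : DirichletCharacter ℂ M ↦ ψ a) h
      simpa [MulChar.pow_apply' κ two_ne_zero, MulChar.one_apply ha] using this
    exact Or.inr (sq_eq_one_iff.mp h2)
  · exact Or.inl (κ.map_nonunit ha)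

/-- **Class-number form of the kernel Hecke consumer**: `NoRealZeroUpTo Q` gives, for every imaginary
quadratic field `K` with `10⁴ ≤ |d_K| ≤ Q`, **`h_K ≥ √|d_K| / (12 π log|d_K|)`** — fact-free (the
primitive Kronecker character `κ` mod `|d_K|`, `lOne_ge_of_noRealZeroUpTo`, and the class number formula
`L(1, κ) = 2π h_K/(w_K √|d_K|)`, `w_K = 2`). Compare `SiegelTatuzawa.classNumber_gt_of_noRealZeroUpTo`
(`1.502` in place of `12`, modulo Hoffstein's Lemma 1). [cite: MontgomeryVaughan2007, §11.2 Thm. 11.14 (Case A)]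
[cite: NeukirchANT1999, Ch. VII §5 (5.11)] -/
theorem classNumber_ge_of_noRealZeroUpTo {Q : ℕ} (hZ : NoRealZeroUpTo Q)
    (K : Type) [Field K] [NumberField K] (h2 : Module.finrank ℚ K = 2) (hd : NumberField.discr K < 0)
    (hD : 10 ^ 4 ≤ (NumberField.discr K).natAbs) (hDQ : (NumberField.discr K).natAbs ≤ Q) :
    Real.sqrt ((NumberField.discr K).natAbs : ℝ) /
        (12 * Real.pi * Real.log ((NumberField.discr K).natAbs : ℝ)) ≤
      (NumberField.classNumber K : ℝ) := by
  classical
  obtain ⟨M, _, κ, hM, hκ, hsq, hprim, hfac⟩ :=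
    Literature.NumberTheory.QuadraticFields.Quadratic.exists_primitive_kroneckerChar h2
  have hquad : κ.IsQuadratic := isQuadratic_of_sq_eq_one κ hsq
  have hMge : 10 ^ 4 ≤ M := by rw [hM]; exact hD
  have hMQ : M ≤ Q := by rw [hM]; exact hDQ
  have hL := lOne_ge_of_noRealZeroUpTo κ hZ hMge hMQ hprim hquad
  -- class number formula, `w_K = 2`
  have hd4 : NumberField.discr K < -4 := by
    have h1 : (10 ^ 4 : ℤ) ≤ ((NumberField.discr K).natAbs : ℤ) := by exact_mod_cast hD
    have h2' : ((NumberField.discr K).natAbs : ℤ) = -NumberField.discr K := by omega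
    omega
  have hcnf := Literature.NumberTheory.QuadraticFields.Quadratic.LFunction_one_eq_of_discr_neg_of_eq h2 hd
    hκ (fun s hs ↦ hfac s (by simpa using hs))
  have hw : (NumberField.Units.torsionOrder K : ℝ) = 2 := by
    exact_mod_cast
      Literature.NumberTheory.QuadraticFields.Quadratic.torsionOrder_eq_two_of_discr_lt_neg_four h2 hd4
  have habs : |(NumberField.discr K : ℝ)| = (M : ℝ) := by
    rw [← Int.cast_abs, Int.abs_eq_natAbs, Int.cast_natCast, hM]
  rw [hcnf, hw, habs, Complex.ofReal_re] at hL
  have hMr : (10 : ℝ) ^ 4 ≤ M := by exact_mod_cast hMge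
  have hlog : 0 < Real.log M := Real.log_pos (by linarith)
  have hsq0 : 0 < Real.sqrt (M : ℝ) := Real.sqrt_pos.2 (by linarith)
  have hπ := Real.pi_pos
  rw [hM] at hL hlog hsq0
  rw [div_le_iff₀ (by positivity)]
  rw [div_le_div_iff₀ (by positivity) (by positivity)] at hL
  nlinarith

/-- The booked decade leaf: `NoRealZeroUpTo_1e10` ⇒ `h_K ≥ √|d_K|/(12π log|d_K|)` for every imaginary
quadratic `K` with `10⁴ ≤ |d_K| ≤ 10¹⁰` — fact-free. [cite: MontgomeryVaughan2007, §11.2 Thm. 11.14 (Case A)] -/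
theorem classNumber_ge_of_leaf_1e10 (hZ : NoRealZeroUpTo_1e10)
    (K : Type) [Field K] [NumberField K] (h2 : Module.finrank ℚ K = 2) (hd : NumberField.discr K < 0)
    (hD : 10 ^ 4 ≤ (NumberField.discr K).natAbs) (hDQ : (NumberField.discr K).natAbs ≤ 10 ^ 10) :
    Real.sqrt ((NumberField.discr K).natAbs : ℝ) /
        (12 * Real.pi * Real.log ((NumberField.discr K).natAbs : ℝ)) ≤
      (NumberField.classNumber K : ℝ) :=
  classNumber_ge_of_noRealZeroUpTo hZ K h2 hd hD (by norm_num at hDQ ⊢; exact hDQ)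


/-! ### Appended 2026-08-27 (rc-cond g7): the constant `1/8` via the squares `(1∗χ)(m²) ≥ 1` -/

/-- `∑_{i < 2n+1} (−1)^i = 1`. [folklore] -/
private theorem sum_range_neg_one_pow_odd (n : ℕ) : ∑ i ∈ range (2 * n + 1), (-1 : ℝ) ^ i = 1 := by
  induction n with
  | zero => simp
  | succ n ih =>
    rw [show 2 * (n + 1) + 1 = 2 * n + 1 + 1 + 1 by ring, Finset.sum_range_succ,
      Finset.sum_range_succ, ih, Odd.neg_one_pow ⟨n, by ring⟩, Even.neg_one_pow ⟨n + 1, by ring⟩]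
    norm_num

omit [NeZero q] in
/-- **`(1∗χ)(m²) ≥ 1`** for a quadratic `χ` and `m ≥ 1`: at a prime power `p^{2k}` the local factor
`∑_{i ≤ 2k} χ(p)^i` is `2k+1`, `1` or `1` according as `χ(p) = 1, 0, −1`, and `1∗χ` is multiplicative.
[folklore] -/
private theorem one_le_zetaMul_sq_re (hq2 : χ ^ 2 = 1) {m : ℕ} (hm : 1 ≤ m) : 1 ≤ (χ.zetaMul (m ^ 2)).re := by
  induction m using Nat.recOnPrimeCoprime with
  | zero => omega
  | prime_pow p k hp =>
    rw [← pow_mul, SmoothEulerProduct.zetaMul_prime_pow_re χ hq2 hp]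
    rcases SmoothEulerProduct.apply_re_trichotomy χ hq2 p with h | h | h <;> rw [h]
    · -- `χ(p) = 0`: the sum is `0^0 = 1`
      rw [Finset.sum_range_succ']
      simp
    · simp
    · rw [show k * 2 + 1 = 2 * k + 1 by ring, sum_range_neg_one_pow_odd]
  | coprime a b ha hb hab iha ihb =>
    rw [mul_pow, SmoothEulerProduct.zetaMul_re_mul χ hq2 (hab.pow 2 2)]
    have h1 := iha (by omega)
    have h2 := ihb (by omega)
    nlinarith

omit [NeZero q] in
/-- The sum over the first six squares: for `0 < β < 1` and `X ≥ 36`,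
`∑_{n ≤ X} (1∗χ)(n) n^{−β} ≥ 1 + 1/4 + 1/9 + 1/16 + 1/25 + 1/36 > 1.4913`. [folklore] -/
private theorem sum_zetaMul_rpow_ge_squares (hq2 : χ ^ 2 = 1) {β : ℝ} (hβ1 : β ≤ 1) {X : ℕ}
    (hX : 36 ≤ X) : 1.4913 ≤ ∑ n ∈ Icc 1 X, (χ.zetaMul n).re * (n : ℝ) ^ (-β) := by
  set f : ℕ → ℝ := fun n => (χ.zetaMul n).re * (n : ℝ) ^ (-β) with hf
  have hnonneg : ∀ n ∈ Icc 1 X, 0 ≤ f n := fun n _ =>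
    mul_nonneg (SmoothEulerProduct.zetaMul_re_nonneg χ hq2 n) (Real.rpow_nonneg (Nat.cast_nonneg n) _)
  -- each square `m²` contributes at least `1/m²`
  have hsq : ∀ m : ℕ, 1 ≤ m → (1 : ℝ) / (m : ℝ) ^ 2 ≤ f (m ^ 2) := by
    intro m hm
    have hm0 : (0 : ℝ) < m := by exact_mod_cast hm
    have hm1 : (1 : ℝ) ≤ (m : ℝ) ^ 2 := by nlinarith [show (1 : ℝ) ≤ m by exact_mod_cast hm]
    have h1 := one_le_zetaMul_sq_re χ hq2 hm
    have h2 : (1 : ℝ) / (m : ℝ) ^ 2 ≤ ((m ^ 2 : ℕ) : ℝ) ^ (-β) := by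
      push_cast
      rw [one_div, ← Real.rpow_neg_one]
      exact Real.rpow_le_rpow_of_exponent_le hm1 (by linarith)
    have h3 : 0 ≤ ((m ^ 2 : ℕ) : ℝ) ^ (-β) := Real.rpow_nonneg (Nat.cast_nonneg _) _
    calc (1 : ℝ) / (m : ℝ) ^ 2 ≤ 1 * ((m ^ 2 : ℕ) : ℝ) ^ (-β) := by rw [one_mul]; exact h2
      _ ≤ f (m ^ 2) := mul_le_mul_of_nonneg_right h1 h3
  have hsub : ({1, 4, 9, 16, 25, 36} : Finset ℕ) ⊆ Icc 1 X := by
    intro n hn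
    simp only [Finset.mem_insert, Finset.mem_singleton] at hn
    rw [Finset.mem_Icc]; omega
  have hle := Finset.sum_le_sum_of_subset_of_nonneg hsub fun n hn _ => hnonneg n hn
  have h1 := hsq 1 le_rfl
  have h2 := hsq 2 (by norm_num)
  have h3 := hsq 3 (by norm_num)
  have h4 := hsq 4 (by norm_num)
  have h5 := hsq 5 (by norm_num)
  have h6 := hsq 6 (by norm_num)
  norm_num at h1 h2 h3 h4 h5 h6
  rw [Finset.sum_insert (by decide), Finset.sum_insert (by decide), Finset.sum_insert (by decide),
    Finset.sum_insert (by decide), Finset.sum_insert (by decide), Finset.sum_singleton] at hle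
  change f 1 + (f 4 + (f 9 + (f 16 + (f 25 + f 36)))) ≤ ∑ n ∈ Icc 1 X, f n at hle
  linarith

/-- The hyperbola inequality at `β = 1 − 1/(4 log q)`, `X = q⁴`, with the sum on the left kept:
`∑_{n≤q⁴}(1∗χ)(n)n^{−β} ≤ 4e log q·∑_{d ≤ q²} χ(d)/d + 2(√e/q²)((q+1)A + 4 log q·q)` (`Re L(β,χ) ≥ 0`,
`q ≥ 10⁴`). [cite: MontgomeryVaughan2007, §11.2 Thm. 11.14 (Case A) and §2.1] -/
private theorem sum_le_main_add_error (hq : 10 ^ 4 ≤ q) (hχ : χ ≠ 1) (hq2 : χ ^ 2 = 1)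
    (hpos : 0 ≤ (χ.LFunction ((1 - 1 / (4 * Real.log q) : ℝ) : ℂ)).re) :
    ∑ n ∈ Icc 1 (q ^ 4), (χ.zetaMul n).re * (n : ℝ) ^ (-(1 - 1 / (4 * Real.log q))) ≤
      4 * Real.exp 1 * Real.log q * ∑ d ∈ Icc 1 (q ^ 2), (χ (d : ZMod q)).re / d +
      2 * (Real.exp (1 / 2) / (q : ℝ) ^ 2) *
        ((q + 1) * ∑ e ∈ Icc 1 (q ^ 2), (e : ℝ) ^ (-(1 - 1 / (4 * Real.log q))) +
          4 * Real.log q * q) := by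
  set L : ℝ := Real.log q with hLdef
  have hqr : (10 : ℝ) ^ 4 ≤ q := by exact_mod_cast hq
  have hq0 : (0 : ℝ) < q := by linarith
  have hL9 : 9 ≤ L := nine_le_log hq
  have hL0 : 0 < L := by linarith
  set β : ℝ := 1 - 1 / (4 * L) with hβdef
  have hκ : 1 - β = 1 / (4 * L) := by rw [hβdef]; ring
  have hβ1 : β < 1 := by
    have h4 : (0 : ℝ) < 1 / (4 * L) := by positivity
    rw [hβdef]; linarith
  have hβ0 : 0 < β := by
    have : 1 / (4 * L) ≤ 1 / 36 := one_div_le_one_div_of_le (by norm_num) (by linarith)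
    rw [hβdef]; linarith
  have hX : 1 ≤ q ^ 4 := Nat.one_le_pow _ _ (by omega)
  have hD : Nat.sqrt (q ^ 4) = q ^ 2 := by
    rw [show q ^ 4 = q ^ 2 * q ^ 2 by ring, Nat.sqrt_eq]
  have hmain := sum_re_zetaMul_mul_rpow_sub_main_le_of_nonneg χ hχ hq2 hβ0 hβ1 hpos hX
  rw [hD] at hmain
  have hq4r : ((q ^ 4 : ℕ) : ℝ) = (q : ℝ) ^ 4 := by push_cast; ring
  have hq2r : ((q ^ 2 : ℕ) : ℝ) = (q : ℝ) ^ 2 := by push_cast; ring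
  have hlog4 : Real.log ((q : ℝ) ^ 4) = 4 * L := by
    rw [Real.log_pow, ← hLdef]; push_cast; ring
  have hlog2 : Real.log ((q : ℝ) ^ 2) = 2 * L := by
    rw [Real.log_pow, ← hLdef]; push_cast; ring
  have hXpow : ((q ^ 4 : ℕ) : ℝ) ^ (1 - β) = Real.exp 1 := by
    rw [hq4r, Real.rpow_def_of_pos (by positivity), hlog4, hκ]
    congr 1
    field_simp
  have hexpL : Real.exp (2 * L) = (q : ℝ) ^ 2 := by
    rw [show (2 : ℝ) * L = ((2 : ℕ) : ℝ) * L by push_cast; ring, Real.exp_nat_mul, hLdef,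
      Real.exp_log hq0]
  have hDpow : ((q ^ 2 : ℕ) : ℝ) ^ (-β) = Real.exp (1 / 2) / (q : ℝ) ^ 2 := by
    rw [hq2r, Real.rpow_def_of_pos (by positivity), hlog2]
    have e1 : 2 * L * -β = 1 / 2 - 2 * L := by
      rw [hβdef]; field_simp; ring
    rw [e1, Real.exp_sub, hexpL]
  rw [hXpow, hDpow, hκ] at hmain
  have hE : Real.exp 1 / (1 / (4 * L)) = 4 * Real.exp 1 * L := by field_simp
  have hT : (q : ℝ) / (1 / (4 * L)) = 4 * L * q := by field_simp
  rw [hE, hT] at hmain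
  linarith

/-- **Hecke's lemma with the constant `1/8` (kernel)**: for every quadratic `χ ≠ χ₀` mod `q ≥ 10⁴`,
if `L(σ, χ) ≠ 0` for all real `σ ∈ [1 − 1/(4 log q), 1]`, then **`Re L(1, χ) ≥ 1/(8 log q)`** —
the `1/12` of `lOne_ge_of_noRealZero_near_one` improved by bounding the hyperbola sum from below by its
first six square terms (`(1∗χ)(m²) ≥ 1`): `1.4913 ≤ 4e log q · L(1,χ) + 0.047`. Compare Lu–Zaman–Zhao's
Corollary 1.3 (`1/(8 log q)` from their narrower window, print) and Hoffstein's `1/(1.502 log q)`.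
[cite: MontgomeryVaughan2007, §11.2 Thm. 11.14 (Case A)] [cite: Hoffstein1980SiegelTatuzawa, Lemma 1 p. 168] -/
theorem lOne_ge_eighth_of_noRealZero_near_one (hq : 10 ^ 4 ≤ q) (hχ : χ ≠ 1) (hq2 : χ ^ 2 = 1)
    (hz : ∀ σ : ℝ, 1 - 1 / (4 * Real.log q) ≤ σ → σ ≤ 1 → χ.LFunction σ ≠ 0) :
    1 / (8 * Real.log q) ≤ (χ.LFunction 1).re := by
  set L : ℝ := Real.log q with hLdef
  have hqr : (10 : ℝ) ^ 4 ≤ q := by exact_mod_cast hq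
  have hq0 : (0 : ℝ) < q := by linarith
  have hL9 : 9 ≤ L := nine_le_log hq
  have hL0 : 0 < L := by linarith
  set β : ℝ := 1 - 1 / (4 * L) with hβdef
  have hκ : 1 - β = 1 / (4 * L) := by rw [hβdef]; ring
  have hβ1 : β < 1 := by
    have h4 : (0 : ℝ) < 1 / (4 * L) := by positivity
    rw [hβdef]; linarith
  have hβ0 : 0 < β := by
    have : 1 / (4 * L) ≤ 1 / 36 := one_div_le_one_div_of_le (by norm_num) (by linarith)
    rw [hβdef]; linarith
  have hpos : 0 < (χ.LFunction β).re :=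
    LFunction_ofReal_re_pos_of_forall_ne_zero χ hχ hq2 hβ0 hβ1.le hz
  have hmain := sum_le_main_add_error χ hq hχ hq2 hpos.le
  have hG := sum_zetaMul_rpow_ge_squares χ hq2 hβ1.le (X := q ^ 4)
    (le_trans (by norm_num) (Nat.pow_le_pow_left hq 4))
  set S₁ : ℝ := ∑ d ∈ Icc 1 (q ^ 2), (χ (d : ZMod q)).re / d with hS₁
  set A : ℝ := ∑ e ∈ Icc 1 (q ^ 2), (e : ℝ) ^ (-β) with hA
  have hq2r : ((q ^ 2 : ℕ) : ℝ) = (q : ℝ) ^ 2 := by push_cast; ring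
  have hlog2 : Real.log ((q : ℝ) ^ 2) = 2 * L := by
    rw [Real.log_pow, ← hLdef]; push_cast; ring
  have hD1pow : ((q ^ 2 : ℕ) : ℝ) ^ (1 - β) = Real.exp (1 / 2) := by
    rw [hq2r, Real.rpow_def_of_pos (by positivity), hlog2, hκ]
    congr 1
    field_simp
    norm_num
  have hAle : A ≤ 1 + Real.exp (1 / 2) * (2 * L) := by
    have h := sum_Icc_rpow_le_log hβ0.le hβ1 (N := q ^ 2) (Nat.one_le_pow _ _ (by omega))
    rw [hD1pow, hq2r, hlog2] at h
    rw [hA]; exact h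
  have hS₁le : S₁ ≤ (χ.LFunction 1).re + 2 * q / ((q : ℝ) ^ 2 + 1) := by
    have hW := CharacterTails.norm_sum_Icc_div_sub_LFunction_one_le χ hχ (W := 2 * q)
      (N := q ^ 2) fun n => norm_sum_Ioc_apply_le χ hχ (q ^ 2) n
    have e : ∑ n ∈ Icc 1 (q ^ 2), χ (n : ZMod q) / n = ((S₁ : ℝ) : ℂ) := by
      rw [hS₁, Complex.ofReal_sum]
      refine Finset.sum_congr rfl fun n _ => ?_
      rw [apply_eq_ofReal_re χ hq2]
      push_cast
      simp
    rw [e] at hW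
    have hre := Complex.abs_re_le_norm (((S₁ : ℝ) : ℂ) - χ.LFunction 1)
    rw [Complex.sub_re, Complex.ofReal_re] at hre
    have h3 := (abs_le.mp (hre.trans hW)).2
    push_cast at h3
    linarith
  obtain ⟨hE1, hE2⟩ := error_terms_le hq
  have he := Real.exp_one_lt_d9
  have he0 := Real.exp_pos (1 : ℝ)
  have hs0 := Real.exp_pos (1 / 2 : ℝ)
  have h1 : 4 * Real.exp 1 * L * S₁ ≤
      4 * Real.exp 1 * L * (χ.LFunction 1).re + 0.0218 := by
    have := mul_le_mul_of_nonneg_left hS₁le (show 0 ≤ 4 * Real.exp 1 * L by positivity)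
    linarith
  have h2 : 2 * (Real.exp (1 / 2) / (q : ℝ) ^ 2) * ((q + 1) * A + 4 * L * q) ≤ 0.0245 := by
    have hmono : (q + 1) * A + 4 * L * q ≤ (q + 1) * (1 + Real.exp (1 / 2) * (2 * L)) + 4 * L * q := by
      have := mul_le_mul_of_nonneg_left hAle (show (0 : ℝ) ≤ q + 1 by positivity)
      linarith
    have := mul_le_mul_of_nonneg_left hmono
      (show 0 ≤ 2 * (Real.exp (1 / 2) / (q : ℝ) ^ 2) by positivity)
    linarith
  have hkey : 1.445 ≤ 4 * Real.exp 1 * (L * (χ.LFunction 1).re) := by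
    have : 1.4913 ≤ 4 * Real.exp 1 * L * S₁ + 2 * (Real.exp (1 / 2) / (q : ℝ) ^ 2) *
        ((q + 1) * A + 4 * L * q) := hG.trans hmain
    linarith
  have hprodpos : 0 < L * (χ.LFunction 1).re := by
    by_contra hcon
    push Not at hcon
    nlinarith
  have hprod : 1.445 ≤ 4 * 2.7182818286 * (L * (χ.LFunction 1).re) := by
    have := mul_le_mul_of_nonneg_right he.le hprodpos.le
    linarith
  rw [div_le_iff₀ (by positivity)]
  nlinarith

/-- **FACT-FREE certified-range consumer, constant `1/8`**: `NoRealZeroUpTo Q` gives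
`Re L(1, χ) ≥ 1/(8 log q)` for every primitive quadratic `χ` mod `q` with `10⁴ ≤ q ≤ Q` (Lu–Zaman–Zhao's
Corollary 1.3 constant, here kernel-proved from the WIDE zero-free row).
[cite: MontgomeryVaughan2007, §11.2 Thm. 11.14 (Case A)] -/
theorem lOne_ge_eighth_of_noRealZeroUpTo {Q : ℕ} (hZ : NoRealZeroUpTo Q) (hq : 10 ^ 4 ≤ q)
    (hqQ : q ≤ Q) (hprim : χ.IsPrimitive) (hquad : χ.IsQuadratic) :
    1 / (8 * Real.log q) ≤ (χ.LFunction 1).re := by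
  have hne : χ ≠ 1 := by
    rintro rfl
    rw [DirichletCharacter.isPrimitive_def, DirichletCharacter.conductor_one] at hprim
    omega
  have hL9 : 9 ≤ Real.log q := nine_le_log hq
  refine lOne_ge_eighth_of_noRealZero_near_one χ hq hne hquad.sq_eq_one fun σ h1 h2 => ?_
  have hσ0 : 0 < σ := by
    have : 1 / (4 * Real.log q) ≤ 1 / 36 := one_div_le_one_div_of_le (by norm_num) (by linarith)
    linarith
  rcases lt_or_eq_of_le h2 with h2 | rfl
  · exact hZ q (by omega) hqQ χ hquad hprim σ hσ0 h2
  · rw [Complex.ofReal_one]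
    exact χ.LFunction_apply_one_ne_zero hne

/-- The booked decade leaf with the constant `1/8`: `NoRealZeroUpTo_1e10` ⇒ `Re L(1, χ) ≥ 1/(8 log q)` for
every primitive quadratic `χ` mod `q`, `10⁴ ≤ q ≤ 10¹⁰` — fact-free.
[cite: MontgomeryVaughan2007, §11.2 Thm. 11.14 (Case A)] -/
theorem lOne_ge_eighth_of_leaf_1e10 (hZ : NoRealZeroUpTo_1e10) (hq : 10 ^ 4 ≤ q) (hqQ : q ≤ 10 ^ 10)
    (hprim : χ.IsPrimitive) (hquad : χ.IsQuadratic) :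
    1 / (8 * Real.log q) ≤ (χ.LFunction 1).re :=
  lOne_ge_eighth_of_noRealZeroUpTo χ hZ hq (by norm_num at hqQ ⊢; exact hqQ) hprim hquad

/-- Class-number form with the constant `1/8`: `NoRealZeroUpTo Q` ⇒ `h_K ≥ √|d_K|/(8π log|d_K|)` for every
imaginary quadratic `K` with `10⁴ ≤ |d_K| ≤ Q` — fact-free. [cite: MontgomeryVaughan2007, §11.2 Thm. 11.14 (Case A)]
[cite: NeukirchANT1999, Ch. VII §5 (5.11)] -/
theorem classNumber_ge_eighth_of_noRealZeroUpTo {Q : ℕ} (hZ : NoRealZeroUpTo Q)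
    (K : Type) [Field K] [NumberField K] (h2 : Module.finrank ℚ K = 2) (hd : NumberField.discr K < 0)
    (hD : 10 ^ 4 ≤ (NumberField.discr K).natAbs) (hDQ : (NumberField.discr K).natAbs ≤ Q) :
    Real.sqrt ((NumberField.discr K).natAbs : ℝ) /
        (8 * Real.pi * Real.log ((NumberField.discr K).natAbs : ℝ)) ≤
      (NumberField.classNumber K : ℝ) := by
  classical
  obtain ⟨M, _, κ, hM, hκ, hsq, hprim, hfac⟩ :=
    Literature.NumberTheory.QuadraticFields.Quadratic.exists_primitive_kroneckerChar h2
  have hquad : κ.IsQuadratic := isQuadratic_of_sq_eq_one κ hsq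
  have hMge : 10 ^ 4 ≤ M := by rw [hM]; exact hD
  have hMQ : M ≤ Q := by rw [hM]; exact hDQ
  have hL := lOne_ge_eighth_of_noRealZeroUpTo κ hZ hMge hMQ hprim hquad
  have hd4 : NumberField.discr K < -4 := by
    have h1 : (10 ^ 4 : ℤ) ≤ ((NumberField.discr K).natAbs : ℤ) := by exact_mod_cast hD
    have h2' : ((NumberField.discr K).natAbs : ℤ) = -NumberField.discr K := by omega
    omega
  have hcnf := Literature.NumberTheory.QuadraticFields.Quadratic.LFunction_one_eq_of_discr_neg_of_eq h2 hd
    hκ (fun s hs ↦ hfac s (by simpa using hs))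
  have hw : (NumberField.Units.torsionOrder K : ℝ) = 2 := by
    exact_mod_cast
      Literature.NumberTheory.QuadraticFields.Quadratic.torsionOrder_eq_two_of_discr_lt_neg_four h2 hd4
  have habs : |(NumberField.discr K : ℝ)| = (M : ℝ) := by
    rw [← Int.cast_abs, Int.abs_eq_natAbs, Int.cast_natCast, hM]
  rw [hcnf, hw, habs, Complex.ofReal_re] at hL
  have hMr : (10 : ℝ) ^ 4 ≤ M := by exact_mod_cast hMge
  have hlog : 0 < Real.log M := Real.log_pos (by linarith)
  have hsq0 : 0 < Real.sqrt (M : ℝ) := Real.sqrt_pos.2 (by linarith)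
  have hπ := Real.pi_pos
  rw [hM] at hL hlog hsq0
  rw [div_le_iff₀ (by positivity)]
  rw [div_le_div_iff₀ (by positivity) (by positivity)] at hL
  nlinarith

end Literature.NumberTheory.LFunctions.Hecke
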